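import Summits.Ventures.LatticeQCDFlow.Exactness.IMHColdStartTwoTime
import Summits.Ventures.LatticeQCDFlow.Exactness.IMHHotStartAcceptance
import Summits.Ventures.LatticeQCDFlow.Exactness.IMHEquilibriumVsHotAcceptance
import HarnessLib

/-!
# The cold start, second order: the exact acceptance-rate law of a cold-started flow-MCMC run — the measured
# acceptance underestimates the equilibrium acceptance by exactly `(ā − A(x₀))·S_N/N`

HONEST FRAMING: exact (Metropolis-corrected) sampling algorithms for lattice gauge theory;
figures of merit are autocorrelation/cost numbers at stated couplings and volumes; no
continuum-physics claim.

Venture `LatticeQCDFlow` (cell pub-lqcd), topic `Exactness`; FANOUT row 30 (lean-1, GEN-32).  NEW WORK of the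
cell, general state space.  `K = indepMH q w`, `w` normalised (`π = w·q`), maximal at `x₀`; `A(x) = ∫ a(x, y) q(dy)`
the acceptance mass at `x` (`IMHKernel.imhAcceptMass`), `A(x₀) = 1/w(x₀)` exactly (GEN-31), `ā = ∫ A dπ` the
EQUILIBRIUM acceptance, `r = 1 − 1/w(x₀)`, `S_N = Σ_{n<N} r^n`.  The acceptance rate is the first figure every
flow-MCMC study prints; a cold-started run measures `(1/N)Σ_{n<N} A(X_n)` in expectation.  Its exact law:

* §1 **`integral_acceptMass_coldStart_mode`** — THE EXPECTED ACCEPTANCE AT STEP `n` OF THE COLD-STARTED RUN IS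
  EXACTLY `E_{x₀}[A(X_n)] = ā − r^n·(ā − 1/w(x₀))` (laws; **`imh_chain_acceptMass_mode`** on path space);
  **`inv_weight_le_averageAccept`** — `1/w(x₀) ≤ ā` (the mode is the stickiest state, `IMHAcceptMonotone`), so
  (**`integral_acceptMass_coldStart_mono`**) THE EXPECTED ACCEPTANCE RISES MONOTONICALLY IN `n` from `1/w(x₀)`
  towards `ā` and never exceeds it (**`integral_acceptMass_coldStart_le_average`**).
* §2 **`imh_chain_acceptRate_mode_eq`** — summed: `Σ_{n<N} E_{x₀}[A(X_n)] = N·ā − (ā − 1/w(x₀))·S_N`, i.e. THE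
  EXPECTED ACCEPTANCE RATE OF A COLD-STARTED RUN OF LENGTH `N` UNDERESTIMATES THE EQUILIBRIUM ACCEPTANCE BY
  EXACTLY `(ā − 1/w(x₀))·S_N/N`; two-sided (**`imh_chain_acceptRate_deficit_two_sided`**):
  `(ā − 1/w(x₀))/(1 + N/w(x₀)) ≤ ā − rate_N ≤ (ā − 1/w(x₀))·min(1, w(x₀)/N)` — the deficit decays like
  `w(x₀)/N`, not geometrically.
* §3 **`integral_moveProb_coldStart_mode`** — atom-free proposal (`q{x} = 0` for all `x`): `K(x, {x}ᶜ) = A(x)`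
  (`IMHHotStartAcceptance.indepMH_apply_compl_singleton`), so the same law is the probability that step `n + 1`
  MOVES the configuration.
* §4 **`coldStart_acceptRate_le_hotStart_accept`** — against the hot start: the expected acceptance at every step of
  the cold-started run is `≤ ā ≤ ∫ A dq` (GEN-31 `IMHEquilibriumVsHotAcceptance`), the first-step acceptance of a
  fresh model draw, itself `≥ 1/2` (`IMHHotStartAcceptance`): ordering `1/w(x₀) ≤ E_{x₀}[A(X_n)] ≤ ā ≤ ∫ A dq`.

Reading (gauge files `Scaling/AutoregressiveGaugeColdStartAcceptance`): with `1/w(cold) = A = Z/(c^{#B}M^k)` resp.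
`Z/∏_ℓ c_{#C_ℓ}`, the acceptance fraction printed by a cold-started exact gauge sampler of length `N` is, in
expectation, the equilibrium acceptance minus exactly `(ā − A)(1 − (1 − A)^N)/(N·A)`.  NOT CLAIMED: the variance of
the measured acceptance rate; the value of `ā` for any weight (GEN-31: `A ≤ ā ≤ ∫ A dq`, `∫ A dq ≥ 1/2`).

No `sorry`, no new definitions, nothing cited as a fact; general measurable space with measurable singletons.
-/

noncomputable section

namespace Summit.Ventures.LatticeQCDFlow.Exactness

open MeasureTheory ProbabilityTheory Function Finset
open scoped ENNReal
open Summit.Ventures.LatticeQCDFlow.Scoring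

variable {Ω : Type*} [MeasurableSpace Ω] [MeasurableSingletonClass Ω]
variable {q : Measure Ω} [IsProbabilityMeasure q] {w : Ω → ℝ}

/-! ## §0 Bookkeeping: the acceptance mass as a bounded measurable real observable -/

omit [MeasurableSingletonClass Ω] in
/-- `x ↦ A(x)` (real) is measurable and bounded by one. [ours, bookkeeping] -/
theorem acceptMass_toReal_facts (hw : Measurable w) :
    Measurable (fun x => (imhAcceptMass q w x).toReal) ∧ ∀ x, |(imhAcceptMass q w x).toReal| ≤ 1 := by
  refine ⟨(measurable_imhAcceptMass q hw).ennreal_toReal, fun x => ?_⟩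
  rw [abs_of_nonneg ENNReal.toReal_nonneg]
  exact ENNReal.toReal_le_of_le_ofReal zero_le_one
    ((imhAcceptMass_le_one q w x).trans_eq ENNReal.ofReal_one.symm)

omit [MeasurableSingletonClass Ω] [IsProbabilityMeasure q] in
/-- At a mode of a normalised weight, `A(x₀) = 1/w(x₀)` (real form of GEN-31's `imhAcceptMass_mode_eq`). [ours,
bookkeeping] -/
theorem acceptMass_toReal_mode (hw0 : ∀ y, 0 < w y) {x₀ : Ω} (hmax : ∀ y, w y ≤ w x₀)
    [IsProbabilityMeasure (q.withDensity fun y => ENNReal.ofReal (w y))] :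
    (imhAcceptMass q w x₀).toReal = (w x₀)⁻¹ := by
  rw [imhAcceptMass_mode_eq hw0 hmax, ENNReal.toReal_ofReal (inv_nonneg.2 (hw0 x₀).le)]

omit [MeasurableSingletonClass Ω] in
/-- **`1/w(x₀) ≤ ā = ∫ A dπ`**: the mode is the stickiest state, so the equilibrium acceptance is at least the cold
acceptance. [ours] -/
theorem inv_weight_le_averageAccept (hw : Measurable w) (hw0 : ∀ y, 0 < w y) {x₀ : Ω} (hmax : ∀ y, w y ≤ w x₀)
    [IsProbabilityMeasure (q.withDensity fun y => ENNReal.ofReal (w y))] :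
    (w x₀)⁻¹ ≤ ∫ x, (imhAcceptMass q w x).toReal ∂(q.withDensity fun y => ENNReal.ofReal (w y)) := by
  obtain ⟨hAm, hAb⟩ := acceptMass_toReal_facts (q := q) hw
  have hpt : ∀ x, (w x₀)⁻¹ ≤ (imhAcceptMass q w x).toReal := fun x => by
    rw [← acceptMass_toReal_mode (q := q) hw0 hmax]
    exact ENNReal.toReal_mono (ne_top_of_le_ne_top ENNReal.one_ne_top (imhAcceptMass_le_one q w x))
      (imhAcceptMass_mode_le hw0 hmax x)
  calc (w x₀)⁻¹ = ∫ _x, (w x₀)⁻¹ ∂(q.withDensity fun y => ENNReal.ofReal (w y)) := by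
        rw [integral_const, probReal_univ, one_smul]
    _ ≤ _ := integral_mono (integrable_const _) (integrable_of_bounded _ hAm hAb) hpt

/-! ## §1 The expected acceptance at step `n`, exactly -/

/-- **`E_{x₀}[A(X_n)] = ā − r^n·(ā − 1/w(x₀))`** (laws): the expected acceptance mass under the cold-started law at
time `n`. [ours] -/
theorem integral_acceptMass_coldStart_mode (hw : Measurable w) (hw0 : ∀ y, 0 < w y) {x₀ : Ω}
    (hmax : ∀ y, w y ≤ w x₀) [IsProbabilityMeasure (q.withDensity fun y => ENNReal.ofReal (w y))] (n : ℕ) :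
    ∫ x, (imhAcceptMass q w x).toReal ∂((fun m : Measure Ω => m.bind (indepMH q w))^[n] (Measure.dirac x₀)) =
      ∫ x, (imhAcceptMass q w x).toReal ∂(q.withDensity fun y => ENNReal.ofReal (w y)) -
        (1 - (w x₀)⁻¹) ^ n *
          (∫ x, (imhAcceptMass q w x).toReal ∂(q.withDensity fun y => ENNReal.ofReal (w y)) - (w x₀)⁻¹) := by
  obtain ⟨hAm, hAb⟩ := acceptMass_toReal_facts (q := q) hw
  rw [integral_coldStart_mode_of_bounded hw hw0 hmax hAm hAb n, acceptMass_toReal_mode hw0 hmax]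
  ring

/-- **Never above equilibrium**: `E_{x₀}[A(X_n)] ≤ ā`. [ours] -/
theorem integral_acceptMass_coldStart_le_average (hw : Measurable w) (hw0 : ∀ y, 0 < w y) {x₀ : Ω}
    (hmax : ∀ y, w y ≤ w x₀) [IsProbabilityMeasure (q.withDensity fun y => ENNReal.ofReal (w y))] (n : ℕ) :
    ∫ x, (imhAcceptMass q w x).toReal ∂((fun m : Measure Ω => m.bind (indepMH q w))^[n] (Measure.dirac x₀)) ≤
      ∫ x, (imhAcceptMass q w x).toReal ∂(q.withDensity fun y => ENNReal.ofReal (w y)) := by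
  have hW : 1 ≤ w x₀ := one_le_of_mode (q := q) hmax
  have hr0 : 0 ≤ 1 - (w x₀)⁻¹ := sub_nonneg.2 (inv_le_one_of_one_le₀ hW)
  rw [integral_acceptMass_coldStart_mode hw hw0 hmax n]
  have h := inv_weight_le_averageAccept (q := q) hw hw0 hmax
  nlinarith [pow_nonneg hr0 n]

/-- **Never below the cold acceptance**: `1/w(x₀) ≤ E_{x₀}[A(X_n)]`. [ours] -/
theorem inv_weight_le_integral_acceptMass_coldStart (hw : Measurable w) (hw0 : ∀ y, 0 < w y) {x₀ : Ω}
    (hmax : ∀ y, w y ≤ w x₀) [IsProbabilityMeasure (q.withDensity fun y => ENNReal.ofReal (w y))] (n : ℕ) :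
    (w x₀)⁻¹ ≤
      ∫ x, (imhAcceptMass q w x).toReal ∂((fun m : Measure Ω => m.bind (indepMH q w))^[n] (Measure.dirac x₀)) := by
  have hW : 1 ≤ w x₀ := one_le_of_mode (q := q) hmax
  have hr0 : 0 ≤ 1 - (w x₀)⁻¹ := sub_nonneg.2 (inv_le_one_of_one_le₀ hW)
  have hr1 : 1 - (w x₀)⁻¹ ≤ 1 := sub_le_self _ (inv_nonneg.mpr (hw0 x₀).le)
  rw [integral_acceptMass_coldStart_mode hw hw0 hmax n]
  have h := inv_weight_le_averageAccept (q := q) hw hw0 hmax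
  nlinarith [pow_le_one₀ hr0 hr1 (n := n)]

/-- **THE EXPECTED ACCEPTANCE RISES MONOTONICALLY** along the cold-started run: `n ↦ E_{x₀}[A(X_n)]` is monotone.
[ours] -/
theorem integral_acceptMass_coldStart_mono (hw : Measurable w) (hw0 : ∀ y, 0 < w y) {x₀ : Ω}
    (hmax : ∀ y, w y ≤ w x₀) [IsProbabilityMeasure (q.withDensity fun y => ENNReal.ofReal (w y))] :
    Monotone fun n : ℕ =>
      ∫ x, (imhAcceptMass q w x).toReal ∂((fun m : Measure Ω => m.bind (indepMH q w))^[n] (Measure.dirac x₀)) := by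
  have hW : 1 ≤ w x₀ := one_le_of_mode (q := q) hmax
  have hr0 : 0 ≤ 1 - (w x₀)⁻¹ := sub_nonneg.2 (inv_le_one_of_one_le₀ hW)
  have hr1 : 1 - (w x₀)⁻¹ ≤ 1 := sub_le_self _ (inv_nonneg.mpr (hw0 x₀).le)
  have h := inv_weight_le_averageAccept (q := q) hw hw0 hmax
  refine monotone_nat_of_le_succ fun n => ?_
  simp only [integral_acceptMass_coldStart_mode hw hw0 hmax]
  have hp : (1 - (w x₀)⁻¹) ^ (n + 1) ≤ (1 - (w x₀)⁻¹) ^ n := by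
    rw [pow_succ]; exact mul_le_of_le_one_right (pow_nonneg hr0 n) hr1
  nlinarith [sub_nonneg.2 h]

/-- **On path space**: `E_{x₀}[A(X_n)] = ā − r^n·(ā − 1/w(x₀))` for the trajectory law from `x₀`. [ours] -/
theorem imh_chain_acceptMass_mode [Fact (Measurable w)] (hw0 : ∀ y, 0 < w y) {x₀ : Ω} (hmax : ∀ y, w y ≤ w x₀)
    [IsProbabilityMeasure (q.withDensity fun y => ENNReal.ofReal (w y))] (n : ℕ) :
    ∫ x, (imhAcceptMass q w (x n)).toReal ∂(Kernel.trajMeasure (X := fun _ : ℕ => Ω) (Measure.dirac x₀)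
        (fun n : ℕ => (indepMH q w).comap (fun h : (i : ↥(Finset.Iic n)) → Ω => h ⟨n, Finset.mem_Iic.2 le_rfl⟩)
          (measurable_pi_apply _))) =
      ∫ x, (imhAcceptMass q w x).toReal ∂(q.withDensity fun y => ENNReal.ofReal (w y)) -
        (1 - (w x₀)⁻¹) ^ n *
          (∫ x, (imhAcceptMass q w x).toReal ∂(q.withDensity fun y => ENNReal.ofReal (w y)) - (w x₀)⁻¹) := by
  obtain ⟨hAm, hAb⟩ := acceptMass_toReal_facts (q := q) (Fact.out : Measurable w)
  rw [chain_expect_eq_integral_iterate_bind (indepMH q w) (Measure.dirac x₀) hAm hAb n]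
  exact integral_acceptMass_coldStart_mode Fact.out hw0 hmax n

/-! ## §2 The expected acceptance rate of a cold-started run of length `N` -/

/-- **THE EXACT ACCEPTANCE-RATE DEFICIT**: `Σ_{n<N} E_{x₀}[A(X_n)] = N·ā − (ā − 1/w(x₀))·S_N`,
`S_N = Σ_{n<N} r^n` — the expected number of accepted proposals among the first `N` of a cold-started run falls
short of `N·ā` by exactly `(ā − 1/w(x₀))·S_N`. [ours] -/
theorem imh_chain_acceptRate_mode_eq [Fact (Measurable w)] (hw0 : ∀ y, 0 < w y) {x₀ : Ω} (hmax : ∀ y, w y ≤ w x₀)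
    [IsProbabilityMeasure (q.withDensity fun y => ENNReal.ofReal (w y))] (N : ℕ) :
    ∑ n ∈ Finset.range N, ∫ x, (imhAcceptMass q w (x n)).toReal
        ∂(Kernel.trajMeasure (X := fun _ : ℕ => Ω) (Measure.dirac x₀)
          (fun n : ℕ => (indepMH q w).comap (fun h : (i : ↥(Finset.Iic n)) → Ω => h ⟨n, Finset.mem_Iic.2 le_rfl⟩)
            (measurable_pi_apply _))) =
      N * ∫ x, (imhAcceptMass q w x).toReal ∂(q.withDensity fun y => ENNReal.ofReal (w y)) -
        (∫ x, (imhAcceptMass q w x).toReal ∂(q.withDensity fun y => ENNReal.ofReal (w y)) - (w x₀)⁻¹) *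
          ∑ n ∈ Finset.range N, (1 - (w x₀)⁻¹) ^ n := by
  simp only [imh_chain_acceptMass_mode hw0 hmax]
  rw [sum_sub_distrib, sum_const, card_range, nsmul_eq_mul, mul_sum]
  congr 1
  exact sum_congr rfl fun n _ => by ring

/-- **TWO-SIDED DEFICIT OF THE MEASURED ACCEPTANCE RATE** (`N ≥ 1`):
`(ā − 1/w(x₀))/(1 + N/w(x₀)) ≤ ā − (1/N)Σ_{n<N} E_{x₀}[A(X_n)] ≤ (ā − 1/w(x₀))·min(1, w(x₀)/N)` — the printed
acceptance of a cold-started run converges to the equilibrium acceptance like `w(x₀)/N`. [ours] -/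
theorem imh_chain_acceptRate_deficit_two_sided [Fact (Measurable w)] (hw0 : ∀ y, 0 < w y) {x₀ : Ω}
    (hmax : ∀ y, w y ≤ w x₀) [IsProbabilityMeasure (q.withDensity fun y => ENNReal.ofReal (w y))] {N : ℕ}
    (hN : N ≠ 0) :
    (∫ x, (imhAcceptMass q w x).toReal ∂(q.withDensity fun y => ENNReal.ofReal (w y)) - (w x₀)⁻¹) *
        (1 / (1 + N * (w x₀)⁻¹)) ≤
      ∫ x, (imhAcceptMass q w x).toReal ∂(q.withDensity fun y => ENNReal.ofReal (w y)) -
        (∑ n ∈ Finset.range N, ∫ x, (imhAcceptMass q w (x n)).toReal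
          ∂(Kernel.trajMeasure (X := fun _ : ℕ => Ω) (Measure.dirac x₀)
            (fun n : ℕ => (indepMH q w).comap (fun h : (i : ↥(Finset.Iic n)) → Ω => h ⟨n, Finset.mem_Iic.2 le_rfl⟩)
              (measurable_pi_apply _)))) / N ∧
    ∫ x, (imhAcceptMass q w x).toReal ∂(q.withDensity fun y => ENNReal.ofReal (w y)) -
        (∑ n ∈ Finset.range N, ∫ x, (imhAcceptMass q w (x n)).toReal
          ∂(Kernel.trajMeasure (X := fun _ : ℕ => Ω) (Measure.dirac x₀)
            (fun n : ℕ => (indepMH q w).comap (fun h : (i : ↥(Finset.Iic n)) → Ω => h ⟨n, Finset.mem_Iic.2 le_rfl⟩)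
              (measurable_pi_apply _)))) / N ≤
      (∫ x, (imhAcceptMass q w x).toReal ∂(q.withDensity fun y => ENNReal.ofReal (w y)) - (w x₀)⁻¹) *
        min 1 (w x₀ / N) := by
  have hNpos : (0 : ℝ) < N := by exact_mod_cast Nat.pos_of_ne_zero hN
  have hgap : 0 ≤ ∫ x, (imhAcceptMass q w x).toReal ∂(q.withDensity fun y => ENNReal.ofReal (w y)) - (w x₀)⁻¹ :=
    sub_nonneg.2 (inv_weight_le_averageAccept (q := q) Fact.out hw0 hmax)
  have hdef : ∫ x, (imhAcceptMass q w x).toReal ∂(q.withDensity fun y => ENNReal.ofReal (w y)) -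
      (∑ n ∈ Finset.range N, ∫ x, (imhAcceptMass q w (x n)).toReal
        ∂(Kernel.trajMeasure (X := fun _ : ℕ => Ω) (Measure.dirac x₀)
          (fun n : ℕ => (indepMH q w).comap (fun h : (i : ↥(Finset.Iic n)) → Ω => h ⟨n, Finset.mem_Iic.2 le_rfl⟩)
            (measurable_pi_apply _)))) / N =
      (∫ x, (imhAcceptMass q w x).toReal ∂(q.withDensity fun y => ENNReal.ofReal (w y)) - (w x₀)⁻¹) *
        ((∑ n ∈ Finset.range N, (1 - (w x₀)⁻¹) ^ n) / N) := by
    rw [imh_chain_acceptRate_mode_eq hw0 hmax N]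
    field_simp
    ring
  rw [hdef]
  have hge := geom_sum_mode_ge (q := q) hw0 hmax N (x₀ := x₀)
  have hle1 := geom_sum_mode_le_card (q := q) hw0 hmax N (x₀ := x₀)
  have hle2 := geom_sum_mode_le_weight (q := q) hw0 hmax N (x₀ := x₀)
  refine ⟨mul_le_mul_of_nonneg_left ?_ hgap, mul_le_mul_of_nonneg_left ?_ hgap⟩
  · rw [le_div_iff₀ hNpos]
    calc 1 / (1 + N * (w x₀)⁻¹) * N = N / (1 + N * (w x₀)⁻¹) := by ring
      _ ≤ _ := hge
  · rw [div_le_iff₀ hNpos, min_mul_of_nonneg _ _ hNpos.le, one_mul, div_mul_cancel₀ _ hNpos.ne']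
    exact le_min hle1 hle2

/-! ## §3 Atom-free proposal: the same law is the probability of moving -/

/-- **`P_{x₀}(step n+1 moves) = ā − r^n(ā − 1/w(x₀))`**: with an atom-free proposal (`q{x} = 0` for every `x`),
`K(x, {x}ᶜ) = A(x)` at every state, so the expected acceptance law is the law of the move probability
`∫ K(x, {x}ᶜ) d(δ_{x₀}K^n)(x)`. [ours] -/
theorem integral_moveProb_coldStart_mode (hw : Measurable w) (hw0 : ∀ y, 0 < w y) {x₀ : Ω}
    (hmax : ∀ y, w y ≤ w x₀) (hq0 : ∀ x, q {x} = 0)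
    [IsProbabilityMeasure (q.withDensity fun y => ENNReal.ofReal (w y))] (n : ℕ) :
    ∫ x, (indepMH q w x {x}ᶜ).toReal ∂((fun m : Measure Ω => m.bind (indepMH q w))^[n] (Measure.dirac x₀)) =
      ∫ x, (imhAcceptMass q w x).toReal ∂(q.withDensity fun y => ENNReal.ofReal (w y)) -
        (1 - (w x₀)⁻¹) ^ n *
          (∫ x, (imhAcceptMass q w x).toReal ∂(q.withDensity fun y => ENNReal.ofReal (w y)) - (w x₀)⁻¹) := by
  have hpt : (fun x => (indepMH q w x {x}ᶜ).toReal) = fun x => (imhAcceptMass q w x).toReal := by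
    funext x; rw [indepMH_apply_compl_singleton hw (hq0 x)]
  rw [hpt]
  exact integral_acceptMass_coldStart_mode hw hw0 hmax n

/-! ## §4 Against the hot start -/

/-- **ORDERING `1/w(x₀) ≤ E_{x₀}[A(X_n)] ≤ ā ≤ ∫ A dq`, and `∫ A dq ≥ 1/2`**: every step of the cold-started run
accepts (in expectation) no more often than the equilibrium chain, which accepts no more often than the first step
from a fresh model draw — which is accepted with probability at least one half. [ours, composing GEN-31] -/
theorem coldStart_acceptRate_le_hotStart_accept (hw : Measurable w) (hw0 : ∀ y, 0 < w y) {x₀ : Ω}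
    (hmax : ∀ y, w y ≤ w x₀) [IsProbabilityMeasure (q.withDensity fun y => ENNReal.ofReal (w y))] (n : ℕ) :
    (w x₀)⁻¹ ≤
        ∫ x, (imhAcceptMass q w x).toReal ∂((fun m : Measure Ω => m.bind (indepMH q w))^[n] (Measure.dirac x₀)) ∧
      ∫ x, (imhAcceptMass q w x).toReal ∂((fun m : Measure Ω => m.bind (indepMH q w))^[n] (Measure.dirac x₀)) ≤
        ∫ x, (imhAcceptMass q w x).toReal ∂(q.withDensity fun y => ENNReal.ofReal (w y)) ∧
      ∫ x, (imhAcceptMass q w x).toReal ∂(q.withDensity fun y => ENNReal.ofReal (w y)) ≤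
        ∫ x, (imhAcceptMass q w x).toReal ∂q ∧
      1 / 2 ≤ ∫ x, (imhAcceptMass q w x).toReal ∂q :=
  ⟨inv_weight_le_integral_acceptMass_coldStart hw hw0 hmax n, integral_acceptMass_coldStart_le_average hw hw0 hmax n,
    integral_imhAcceptMass_target_le_model hw hw0, half_le_integral_imhAcceptMass hw hw0⟩

end Summit.Ventures.LatticeQCDFlow.Exactness
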